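import Literature.Probability.LatticeModels.ClusterExpansionKPBound
import Literature.Probability.LatticeModels.PolymerLogZLipschitz
import HarnessLib

/-!
# The truncated functionals of an abstract polymer gas are Lipschitz in the activities
# (Kotecký–Preiss regime, weighted `ℓ¹` form)

A fifth small layer on the tree's abstract Kotecký–Preiss cluster-expansion layer
(`PolymerGas`, `ClusterExpansion`, `ClusterExpansionActivityPaths`, `ClusterExpansionKPBound`,
`PolymerLogZLipschitz`): polymers `P` with a reflexive symmetric incompatibility `inc` (`ι`),
complex activities `w : P → ℂ`, the finite-volume partition functions
`polymerPartitionFunction inc w B`, their Kotecký–Preiss logarithms `polymerLogZ inc w B`, the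
truncated functionals `truncatedWeight inc w C = Σ_{B ⊆ C} (-1)^{|C∖B|} log Z(B; w)` (so that
`log Z(L; w) = Σ_{C ⊆ L} Φ^T(C; w)`, `polymerLogZ_eq_sum_truncatedWeight`), and two functions
`a, d ≥ 0` entering the hypothesis (1) of [KP86] in the finite volume `L`:
`Σ_{γ' ∈ L, γ' ι γ} ‖w γ'‖ e^{a γ' + d γ'} ≤ a γ` for `γ ∈ L`.

**What this file adds.** The COMPARISON of the truncated functionals of ONE polymer system
under TWO activity families `wA`, `wB` which both satisfy (1) with the same `a, d` on the same
finite volume `L` (no sign or positivity assumption on the activities):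

* `kpd_activitySegment`: hypothesis (1) (with `d`) is convex in the norms of the activities, so
  it holds along the segment `wB + s (wA - wB)`, `s ∈ [0, 1]` (`activitySegment` of
  `PolymerLogZLipschitz`); `isKPVolume_of_kpd` drops `d ≥ 0` to the tree's `IsKPVolume`;
* `sum_norm_truncatedWeight_sub_mul_exp_le` (**the truncated functionals are Lipschitz in the
  activities, in weighted `ℓ¹`**):
  `Σ_{C ⊆ L} ‖Φ^T(C; wA) - Φ^T(C; wB)‖ e^{d(C)} ≤ Σ_{δ ∈ L} ‖wA δ - wB δ‖ e^{a δ + d δ}`,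
  `d(C) = Σ_{γ ∈ C} d γ`. This is the two-family companion of the Kotecký–Preiss estimate (4)
  (`touchSum_le_of_kp`: `Σ_{C ⊆ L, C ι γ} ‖Φ^T(C; w)‖ e^{d(C)} ≤ a γ` for ONE family) and the
  piecewise refinement of `norm_polymerLogZ_sub_polymerLogZ_le` of `PolymerLogZLipschitz`
  (`‖log Z(L; wA) - log Z(L; wB)‖ ≤ Σ_δ ‖wA δ - wB δ‖ e^{a δ}`, which is the `d = 0`, unweighted
  and GLOBAL consequence: summing the pieces loses the weights `e^{d(C)}`);
* consequences in the shapes consumers use: `norm_truncatedWeight_sub_mul_exp_le` (one piece),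
  `sum_filter_norm_truncatedWeight_sub_mul_exp_le` (any sub-family of pieces — e.g. the pieces
  anchored at a polymer or at a region), `sum_filter_norm_truncatedWeight_sub_le_exp_neg_mul`
  (**decay survives subtraction**: the pieces of a sub-family all of whose members have
  `d(C) ≥ m` differ, in total, by at most `e^{-m} Σ_δ ‖wA δ - wB δ‖ e^{a δ + d δ}`), and
  `sum_norm_truncatedWeight_sub_mul_exp_le_of_rate` (the RATE form: if
  `‖wA δ - wB δ‖ ≤ ε u δ` on `L` then the bound is `ε Σ_δ u δ e^{a δ + d δ}`);
* the ANCHORED form with a LOCAL right-hand side (v1.1). With a second weight `e ≥ 0` entering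
  hypothesis (1) as `d + e` and kept as a SURPLUS: `sum_filter_norm_truncatedWeight_sub_mul_exp_le_exp_neg_mul`
  (a sub-family all of whose members have surplus `e(C) ≥ m` differs, in `e^{d(C)}`-weighted
  total, by at most `e^{-m} Σ_δ ‖wA δ - wB δ‖ e^{a δ + d δ + e δ}`);
  `sum_filter_norm_truncatedWeight_sub_mul_exp_le_of_eqOn_compl` (two families AGREEING on `L`
  off a set `T`: only the clusters meeting `T` contribute, so the surplus hypothesis is only
  needed on the clusters `C` of the sub-family that meet `T` — `truncatedWeight_congr` and
  `truncatedWeight_eq_zero_of_kp`); and, switching the activities one polymer at a time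
  (`Finset.piecewise`, every hybrid family satisfying (1) through a common dominating profile
  `ω ≥ ‖wA‖, ‖wB‖` — `kpd_of_norm_le`), the **local bound**
  `sum_filter_norm_truncatedWeight_sub_mul_exp_le_local`:
  `Σ_{C ⊆ L, p C} ‖Φ^T(C; wA) - Φ^T(C; wB)‖ e^{d(C)} ≤ Σ_{δ ∈ L} e^{-m(δ)} ‖wA δ - wB δ‖ e^{a δ + d δ + e δ}`
  whenever every CLUSTER `C ⊆ L` of the sub-family `p` through `δ` has surplus `e(C) ≥ m(δ)`
  (for `p C = C ι γ` and `e` a size, `m(δ)` is the cost of joining `δ` to the anchor `γ`: the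
  discrepancy at `δ` is discounted by its separation from the anchor);
* LOCALIZED PIECES (v1.2): for a localization map `loc : Finset P → ι` (every potential cluster
  gets a domain) the pieces of `log Z(L; w)` are `R_w(i) = Σ_{C ⊆ L, loc C = i} Φ^T(C; w)`;
  `sum_exp_mul_norm_sum_truncatedWeight_sub_le_of_loc`: if `κ (loc C) ≤ d(C)` on `L` then
  `Σ_{i ∈ I} e^{κ i} ‖R_{wA}(i) - R_{wB}(i)‖ ≤ Σ_{δ ∈ L} ‖wA δ - wB δ‖ e^{a δ + d δ}` — the decay
  profile `κ` of the pieces survives the two-family subtraction (distinct pieces collect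
  disjoint families of clusters).
* CLUSTER-RESTRICTED PROFILE (v1.3): `sum_exp_mul_norm_sum_truncatedWeight_sub_le_of_loc_cluster`
  — the same bound with `κ (loc C) ≤ d(C)` demanded ONLY on the NONEMPTY `inc`-CLUSTERS `C ⊆ L`
  (the families on which a covering-type subadditivity of the weight can hold at all; a
  consumer's subadditivity leaf is typically FALSE on non-clusters): non-clusters carry
  `Φ^T(C; wA) - Φ^T(C; wB) = 0 - 0` ([KP86] Theorem, last assertion — the tree's
  `truncatedWeight_eq_zero_of_kp`) and the empty family the same value in both families
  (`truncatedWeight_congr`). Strictly stronger than the v1.2 form; first consumer: the cell's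
  `Balaban1983to89.B16Exp198TwoRun` (two-run bound for the pieces of Bałaban's (1.98)).

**Proof** ([KP86, §3], the proof of (4), run along the SEGMENT between the two families instead
of the scaling path of [KP86, (12)]; all ingredients are the tree's). For `C ⊆ L`, by the
log-increment identity on every `B ⊆ C` (`integral_div_eq_sub_of_exp_eq`: the KP logarithm is a
continuous logarithm of the non-vanishing `C¹` function `s ↦ Z(B; w_s)` along the segment,
`continuousOn_polymerLogZ_param`, `exp_polymerLogZ_of_kp`),
`Φ^T(C; wA) - Φ^T(C; wB) = ∫₀¹ Σ_{B ⊆ C} (-1)^{|C∖B|} Ż_s(B)/Z_s(B) ds`; by the chain rule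
([KP86, (13)], `hasDerivAt_polymerPartitionFunction_path`) and the ratio-through-clusters
identity ([KP86, (5)], `polymerPartitionFunction_sdiff_div_eq_exp`)
`Ż_s(B)/Z_s(B) = Σ_{δ ∈ B} (wA δ - wB δ) exp(-Σ_{D ⊆ B, D ι δ} Φ^T(D; w_s))`; the
Möbius–exponential bound (`sum_exp_mul_norm_moebius_le`, [KP86, p. 497]) and the estimate (4) for
`w_s` (`touchSum_le_of_kp`, available since `w_s` satisfies (1) by convexity) bound the weighted
sum of the integrands by `Σ_{δ ∈ L} ‖wA δ - wB δ‖ e^{d δ} e^{a δ}`, uniformly in `s ∈ [0, 1]`;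
integrate. The local bound is the telescoping of the one-set case over the polymers of `L`.

Everything is PROVED; no named fact and no new definition is introduced. The Kotecký–Preiss
paper is cited for the device (§3, (12)–(13), (5) and the Theorem p. 492), not for the
statements, which are folklore consequences of it (the Lipschitz dependence of the cluster
expansion on the activities; cf. the remark after (4) in [KP86] on the analyticity of `Φ^T` in
the activities).

**Use (context only, nothing of it is asserted here).** When the effective densities of two runs
of a multi-step renormalisation scheme are written, after exponentiation, as polymer gases whose
logarithms are split into LOCALIZED pieces `Σ_X R(X)` with tree decay `e^{-κ d(X)}` (the pieces
being sums of truncated functionals over the clusters with localization domain `X`, and `d(C)`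
dominating `κ d(X(C))`), the two runs' pieces are compared piece by piece by
`sum_filter_norm_truncatedWeight_sub_le_exp_neg_mul`: the decay of the pieces survives the
subtraction, with the activity discrepancy as the rate. The global comparison of
`PolymerLogZLipschitz` cannot be redistributed over the pieces; this file supplies the piecewise
currency.

## References

* [KP86] R. Kotecký, D. Preiss, *Cluster expansion for abstract polymer models*,
  Comm. Math. Phys. 103 (1986) 491–498: Theorem p. 492 with (1), (4), (5); §3, (12)–(13) and the
  estimate following (12) on p. 497. [KoteckyPreiss1986]
-/

open Finset Set MeasureTheory intervalIntegral
open scoped BigOperators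

namespace Literature.Probability.LatticeModels

variable {P : Type*} [DecidableEq P] {inc : P → P → Prop} [DecidableRel inc]

/-! ### Hypothesis (1) along the segment between two activity families -/

omit [DecidableEq P] in
/-- **Hypothesis (1) of [KP86] is convex in the norms of the activities**: if `wA` and `wB`
satisfy `Σ_{γ' ∈ L, γ' ι γ} ‖w γ'‖ e^{a γ' + d γ'} ≤ a γ` for all `γ ∈ L`, so does every point
`wB + s (wA - wB)`, `s ∈ [0, 1]`, of the segment between them. [folklore] -/
theorem kpd_activitySegment {wA wB : P → ℂ} {a d : P → ℝ} {L : Finset P}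
    (h1A : ∀ γ ∈ L, ∑ γ' ∈ L with inc γ' γ, ‖wA γ'‖ * Real.exp (a γ' + d γ') ≤ a γ)
    (h1B : ∀ γ ∈ L, ∑ γ' ∈ L with inc γ' γ, ‖wB γ'‖ * Real.exp (a γ' + d γ') ≤ a γ)
    {s : ℝ} (hs : s ∈ Set.Icc (0 : ℝ) 1) :
    ∀ γ ∈ L, ∑ γ' ∈ L with inc γ' γ,
      ‖activitySegment wA wB s γ'‖ * Real.exp (a γ' + d γ') ≤ a γ := by
  intro γ hγ
  have h1s : 0 ≤ 1 - s := by linarith [hs.2]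
  calc ∑ γ' ∈ L with inc γ' γ, ‖activitySegment wA wB s γ'‖ * Real.exp (a γ' + d γ')
      ≤ ∑ γ' ∈ L with inc γ' γ, ((1 - s) * (‖wB γ'‖ * Real.exp (a γ' + d γ')) +
          s * (‖wA γ'‖ * Real.exp (a γ' + d γ'))) := by
        refine Finset.sum_le_sum fun γ' _ => ?_
        have h := mul_le_mul_of_nonneg_right (norm_activitySegment_le wA wB hs γ')
          (Real.exp_nonneg (a γ' + d γ'))
        exact h.trans (le_of_eq (by ring))
    _ = (1 - s) * ∑ γ' ∈ L with inc γ' γ, ‖wB γ'‖ * Real.exp (a γ' + d γ') +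
          s * ∑ γ' ∈ L with inc γ' γ, ‖wA γ'‖ * Real.exp (a γ' + d γ') := by
        rw [Finset.sum_add_distrib, Finset.mul_sum, Finset.mul_sum]
    _ ≤ (1 - s) * a γ + s * a γ :=
        add_le_add (mul_le_mul_of_nonneg_left (h1B γ hγ) h1s)
          (mul_le_mul_of_nonneg_left (h1A γ hγ) hs.1)
    _ = a γ := by ring

omit [DecidableEq P] in
/-- Hypothesis (1) with `d ≥ 0` implies the finite-volume Kotecký–Preiss condition
`IsKPVolume` (drop the weight `e^{d γ'} ≥ 1`). [cite: KoteckyPreiss1986, (1)] -/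
theorem isKPVolume_of_kpd {w : P → ℂ} {a d : P → ℝ} (hd : ∀ γ, 0 ≤ d γ) {L : Finset P}
    (h1 : ∀ γ ∈ L, ∑ γ' ∈ L with inc γ' γ, ‖w γ'‖ * Real.exp (a γ' + d γ') ≤ a γ) :
    IsKPVolume inc w a L := fun γ hγ => by
  refine le_trans (Finset.sum_le_sum fun γ' _ => ?_) (h1 γ hγ)
  unfold kpTerm
  exact mul_le_mul_of_nonneg_left (Real.exp_le_exp.2 (le_add_of_nonneg_right (hd γ')))
    (norm_nonneg _)

/-! ### The weighted `ℓ¹` Lipschitz bound for the truncated functionals -/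

/-- **The truncated functionals are Lipschitz in the activities (weighted `ℓ¹` form).** If
`a, d ≥ 0` and both activity families `wA`, `wB` satisfy hypothesis (1) of [KP86] on the finite
volume `L`, `Σ_{γ' ∈ L, γ' ι γ} ‖w γ'‖ e^{a γ' + d γ'} ≤ a γ` (`γ ∈ L`), then
`Σ_{C ⊆ L} ‖Φ^T(C; wA) - Φ^T(C; wB)‖ e^{d(C)} ≤ Σ_{δ ∈ L} ‖wA δ - wB δ‖ e^{a δ + d δ}`.
Proof: [KP86, §3]'s proof of (4) along the segment `w_s = wB + s (wA - wB)`: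
`Φ^T(C; wA) - Φ^T(C; wB) = ∫₀¹ Σ_{B ⊆ C} (-1)^{|C∖B|} Ż_s(B)/Z_s(B) ds` (log-increment identity),
`Ż_s(B)/Z_s(B) = Σ_{δ ∈ B} (wA δ - wB δ) exp(-Σ_{D ⊆ B, D ι δ} Φ^T(D; w_s))` ((13) and (5)),
then the Möbius–exponential bound and (4) for `w_s`.
[cite: KoteckyPreiss1986, §3 (12)–(13) and p. 497; Theorem p. 492 (4), (5)] -/
theorem sum_norm_truncatedWeight_sub_mul_exp_le [Std.Refl inc] [Std.Symm inc]
    {wA wB : P → ℂ} {a d : P → ℝ} (ha : ∀ γ, 0 ≤ a γ) (hd : ∀ γ, 0 ≤ d γ) {L : Finset P}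
    (h1A : ∀ γ ∈ L, ∑ γ' ∈ L with inc γ' γ, ‖wA γ'‖ * Real.exp (a γ' + d γ') ≤ a γ)
    (h1B : ∀ γ ∈ L, ∑ γ' ∈ L with inc γ' γ, ‖wB γ'‖ * Real.exp (a γ' + d γ') ≤ a γ) :
    ∑ C ∈ L.powerset, ‖truncatedWeight inc wA C - truncatedWeight inc wB C‖ *
        Real.exp (∑ γ ∈ C, d γ) ≤
      ∑ δ ∈ L, ‖wA δ - wB δ‖ * Real.exp (a δ + d δ) := by
  -- notation: the segment, the partition functions along it and their derivatives
  set v : ℝ → P → ℂ := activitySegment wA wB with hv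
  have hv1 : v 1 = wA := by simp only [hv, activitySegment_one]
  have hv0 : v 0 = wB := by simp only [hv, activitySegment_zero]
  have h1t : ∀ t ∈ Set.Icc (0 : ℝ) 1, ∀ γ ∈ L,
      ∑ γ' ∈ L with inc γ' γ, ‖v t γ'‖ * Real.exp (a γ' + d γ') ≤ a γ := fun t ht =>
    kpd_activitySegment h1A h1B ht
  have hKPt : ∀ t ∈ Set.Icc (0 : ℝ) 1, IsKPVolume inc (v t) a L := fun t ht =>
    isKPVolume_of_kpd hd (h1t t ht)
  -- `(S)` of [KP86, §3] along the segment: the estimate (4) for `w_t`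
  have hS : ∀ t ∈ Set.Icc (0 : ℝ) 1, ∀ δ ∈ L, touchSum inc (v t) d L δ ≤ a δ :=
    fun t ht δ hδ => touchSum_le_of_kp ha hd (h1t t ht) hδ
  set ζ : Finset P → ℝ → ℂ := fun B t => polymerPartitionFunction inc (v t) B with hζ
  set ζ' : Finset P → ℝ → ℂ := fun B t => ∑ δ ∈ B,
    (wA δ - wB δ) * polymerPartitionFunction inc (v t) (B.filter fun γ' => ¬ inc γ' δ) with hζ'
  -- (a) derivative ([KP86, (13)]), (b) zero-freeness, (c) continuity, (d) `exp log = Z`,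
  -- (e) continuity of `log` along the segment
  have hderiv : ∀ B t, HasDerivAt (ζ B) (ζ' B t) t := fun B t =>
    hasDerivAt_polymerPartitionFunction_path B fun δ _ => hasDerivAt_activitySegment wA wB δ t
  have hne : ∀ B ⊆ L, ∀ t ∈ Set.Icc (0 : ℝ) 1, ζ B t ≠ 0 := fun B hB t ht =>
    polymerPartitionFunction_ne_zero_of_kp (hKPt t ht) hB
  have hζc : ∀ B, Continuous (ζ B) := fun B =>
    continuous_iff_continuousAt.2 fun t => (hderiv B t).continuousAt
  have hζ'c : ∀ B, Continuous (ζ' B) := by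
    intro B
    simp only [hζ', hv]
    refine continuous_finsetSum _ fun δ _ => continuous_const.mul ?_
    exact continuous_iff_continuousAt.2 fun t =>
      (hasDerivAt_polymerPartitionFunction_path (inc := inc) (B.filter fun γ' => ¬ inc γ' δ)
        fun δ' _ => hasDerivAt_activitySegment wA wB δ' t).continuousAt
  have hexp : ∀ B ⊆ L, ∀ t ∈ Set.Icc (0 : ℝ) 1,
      Complex.exp (polymerLogZ inc (v t) B) = ζ B t := fun B hB t ht =>
    exp_polymerLogZ_of_kp (hKPt t ht) hB
  have hrays : ∀ B ⊆ L, ∀ s ∈ Set.Icc (0 : ℝ) 1, ∀ u ∈ Set.Icc (0 : ℝ) 1,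
      polymerPartitionFunction inc (fun γ => (u : ℂ) * v s γ) B ≠ 0 := fun B hB s hs u hu =>
    polymerPartitionFunction_ne_zero_of_kp ((hKPt s hs).ray hu) hB
  have hlogc : ∀ B ⊆ L, ContinuousOn (fun t => polymerLogZ inc (v t) B) (Set.Icc 0 1) :=
    fun B hB => continuousOn_polymerLogZ_param (inc := inc) B
      (fun γ _ => (continuous_activitySegment wA wB γ).continuousOn) (hrays B hB)
  -- (f) the log-increment identity on each `B ⊆ L`
  have hincr : ∀ B ⊆ L, ∫ t in (0 : ℝ)..1, ζ' B t / ζ B t =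
      polymerLogZ inc wA B - polymerLogZ inc wB B := by
    intro B hB
    have h := integral_div_eq_sub_of_exp_eq zero_le_one (hlogc B hB) (fun t _ => hderiv B t)
      (hζ'c B).continuousOn (hne B hB) (hexp B hB)
    rw [h, hv1, hv0]
  -- the integrand `f C t = Σ_{B ⊆ C} (-1)^{|C∖B|} Ż_t(B)/Z_t(B)`
  set f : Finset P → ℝ → ℂ := fun C t =>
    ∑ B ∈ C.powerset, (-1 : ℂ) ^ (C \ B).card * (ζ' B t / ζ B t) with hf
  have hfBc : ∀ C ⊆ L, ∀ B ∈ C.powerset,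
      ContinuousOn (fun t => (-1 : ℂ) ^ (C \ B).card * (ζ' B t / ζ B t)) (Set.uIcc 0 1) := by
    intro C hC B hB
    have hBL : B ⊆ L := (Finset.mem_powerset.1 hB).trans hC
    rw [Set.uIcc_of_le zero_le_one]
    exact continuousOn_const.mul ((hζ'c B).continuousOn.div (hζc B).continuousOn (hne B hBL))
  have hfc : ∀ C ⊆ L, ContinuousOn (f C) (Set.uIcc 0 1) := fun C hC =>
    continuousOn_finsetSum _ fun B hB => hfBc C hC B hB
  -- (h) `Φ^T(C; wA) - Φ^T(C; wB) = ∫₀¹ f C`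
  have hrep : ∀ C ⊆ L,
      truncatedWeight inc wA C - truncatedWeight inc wB C = ∫ t in (0 : ℝ)..1, f C t := by
    intro C hC
    simp only [hf]
    rw [intervalIntegral.integral_finsetSum fun B hB => (hfBc C hC B hB).intervalIntegrable]
    unfold truncatedWeight
    rw [← Finset.sum_sub_distrib]
    refine Finset.sum_congr rfl fun B hB => ?_
    have hBL : B ⊆ L := (Finset.mem_powerset.1 hB).trans hC
    rw [← mul_sub, ← hincr B hBL, intervalIntegral.integral_const_mul]
  -- (i) the ratio `Z(B∖[δ])/Z(B)` through clusters ([KP86, (5)])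
  have hratio : ∀ B ⊆ L, ∀ t ∈ Set.Icc (0 : ℝ) 1, ∀ δ : P,
      polymerPartitionFunction inc (v t) (B.filter fun γ' => ¬ inc γ' δ) / ζ B t =
        Complex.exp (-∑ D ∈ B.powerset with KPTouches inc D δ, truncatedWeight inc (v t) D) := by
    intro B hB t ht δ
    have h5 := polymerPartitionFunction_sdiff_div_eq_exp (inc := inc) (w := v t) (a := a) (Λ := B)
      (D := B.filter fun γ' => inc γ' δ) ((hKPt t ht).mono hB)
    rw [sdiff_filter_inc_eq] at h5
    simp only [hζ]
    rw [h5]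
    congr 2
    refine Finset.sum_congr (Finset.filter_congr fun D hD => ?_) fun _ _ => rfl
    have hDB : D ⊆ B := Finset.mem_powerset.1 hD
    constructor
    · rintro ⟨x, hx⟩
      rw [Finset.mem_inter, Finset.mem_filter] at hx
      exact ⟨x, hx.1, hx.2.2⟩
    · rintro ⟨x, hxD, hx⟩
      exact ⟨x, Finset.mem_inter.2 ⟨hxD, Finset.mem_filter.2 ⟨hDB hxD, hx⟩⟩⟩
  -- the Möbius-extracted exponential
  set Mo : P → ℝ → Finset P → ℂ := fun δ t C => ∑ B ∈ C.powerset, (-1 : ℂ) ^ (C \ B).card *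
    (if δ ∈ B then Complex.exp (-∑ D ∈ B.powerset with KPTouches inc D δ,
      truncatedWeight inc (v t) D) else 0) with hMo
  -- (i') pointwise identity `f C t = Σ_{δ ∈ C} (wA δ - wB δ) Mo δ t C`
  have hfC : ∀ C ⊆ L, ∀ t ∈ Set.Icc (0 : ℝ) 1,
      f C t = ∑ δ ∈ C, (wA δ - wB δ) * Mo δ t C := by
    intro C hC t ht
    have hB : ∀ B ∈ C.powerset, (-1 : ℂ) ^ (C \ B).card * (ζ' B t / ζ B t) =
        ∑ δ ∈ C, (wA δ - wB δ) * ((-1 : ℂ) ^ (C \ B).card *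
          (if δ ∈ B then Complex.exp (-∑ D ∈ B.powerset with KPTouches inc D δ,
            truncatedWeight inc (v t) D) else 0)) := by
      intro B hB
      have hBC : B ⊆ C := Finset.mem_powerset.1 hB
      have hBL : B ⊆ L := hBC.trans hC
      have h1 : ζ' B t / ζ B t = ∑ δ ∈ B, (wA δ - wB δ) *
          Complex.exp (-∑ D ∈ B.powerset with KPTouches inc D δ, truncatedWeight inc (v t) D) := by
        simp only [hζ']
        rw [Finset.sum_div]
        refine Finset.sum_congr rfl fun δ _ => ?_
        rw [mul_div_assoc, hratio B hBL t ht δ]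
      have h2 : ∑ δ ∈ B, (wA δ - wB δ) *
          Complex.exp (-∑ D ∈ B.powerset with KPTouches inc D δ, truncatedWeight inc (v t) D) =
          ∑ δ ∈ C, (wA δ - wB δ) *
            (if δ ∈ B then Complex.exp (-∑ D ∈ B.powerset with KPTouches inc D δ,
              truncatedWeight inc (v t) D) else 0) := by
        have hF : ∑ δ ∈ B, (wA δ - wB δ) *
            Complex.exp (-∑ D ∈ B.powerset with KPTouches inc D δ, truncatedWeight inc (v t) D) =
            ∑ δ ∈ B, (wA δ - wB δ) *
              (if δ ∈ B then Complex.exp (-∑ D ∈ B.powerset with KPTouches inc D δ,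
                truncatedWeight inc (v t) D) else 0) :=
          Finset.sum_congr rfl fun δ hδ => by rw [if_pos hδ]
        rw [hF]
        exact Finset.sum_subset hBC fun δ _ hδB => by rw [if_neg hδB, mul_zero]
      rw [h1, h2, Finset.mul_sum]
      refine Finset.sum_congr rfl fun δ _ => ?_
      split_ifs <;> ring
    simp only [hf, hMo]
    rw [Finset.sum_congr rfl hB, Finset.sum_comm]
    refine Finset.sum_congr rfl fun δ _ => ?_
    rw [Finset.mul_sum]
  -- (j) pointwise bound on the weighted sum of the integrands, via the Möbius–exponential bound
  set K : ℝ := ∑ δ ∈ L, ‖wA δ - wB δ‖ * Real.exp (a δ + d δ) with hK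
  have hpt : ∀ t ∈ Set.Icc (0 : ℝ) 1,
      ∑ C ∈ L.powerset, ‖f C t‖ * Real.exp (∑ γ ∈ C, d γ) ≤ K := by
    intro t ht
    -- norm bound for each `C`
    have hnC : ∀ C ∈ L.powerset,
        ‖f C t‖ * Real.exp (∑ γ ∈ C, d γ) ≤
          ∑ δ ∈ L, ‖wA δ - wB δ‖ * (Real.exp (∑ γ ∈ C, d γ) * ‖Mo δ t C‖) := by
      intro C hC
      have hCL : C ⊆ L := Finset.mem_powerset.1 hC
      rw [hfC C hCL t ht]
      calc ‖∑ δ ∈ C, (wA δ - wB δ) * Mo δ t C‖ * Real.exp (∑ γ ∈ C, d γ)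
          ≤ (∑ δ ∈ C, ‖wA δ - wB δ‖ * ‖Mo δ t C‖) * Real.exp (∑ γ ∈ C, d γ) := by
            refine mul_le_mul_of_nonneg_right ((norm_sum_le _ _).trans (le_of_eq ?_))
              (Real.exp_nonneg _)
            exact Finset.sum_congr rfl fun δ _ => norm_mul _ _
        _ ≤ (∑ δ ∈ L, ‖wA δ - wB δ‖ * ‖Mo δ t C‖) * Real.exp (∑ γ ∈ C, d γ) := by
            refine mul_le_mul_of_nonneg_right (Finset.sum_le_sum_of_subset_of_nonneg hCL
              fun δ _ _ => ?_) (Real.exp_nonneg _)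
            exact mul_nonneg (norm_nonneg _) (norm_nonneg _)
        _ = ∑ δ ∈ L, ‖wA δ - wB δ‖ * (Real.exp (∑ γ ∈ C, d γ) * ‖Mo δ t C‖) := by
            rw [Finset.sum_mul]
            exact Finset.sum_congr rfl fun δ _ => by ring
    calc ∑ C ∈ L.powerset, ‖f C t‖ * Real.exp (∑ γ ∈ C, d γ)
        ≤ ∑ C ∈ L.powerset, ∑ δ ∈ L,
            ‖wA δ - wB δ‖ * (Real.exp (∑ γ ∈ C, d γ) * ‖Mo δ t C‖) :=
          Finset.sum_le_sum hnC
      _ = ∑ δ ∈ L, ‖wA δ - wB δ‖ *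
            ∑ C ∈ L.powerset, Real.exp (∑ γ ∈ C, d γ) * ‖Mo δ t C‖ := by
          rw [Finset.sum_comm]
          exact Finset.sum_congr rfl fun δ _ => by rw [Finset.mul_sum]
      _ ≤ ∑ δ ∈ L, ‖wA δ - wB δ‖ * (Real.exp (d δ) * Real.exp (touchSum inc (v t) d L δ)) := by
          refine Finset.sum_le_sum fun δ _ => mul_le_mul_of_nonneg_left ?_ (norm_nonneg _)
          exact sum_exp_mul_norm_moebius_le (truncatedWeight inc (v t)) (fun D => KPTouches inc D δ)
            hd L δ
      _ ≤ ∑ δ ∈ L, ‖wA δ - wB δ‖ * (Real.exp (d δ) * Real.exp (a δ)) := by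
          refine Finset.sum_le_sum fun δ hδ => mul_le_mul_of_nonneg_left ?_ (norm_nonneg _)
          exact mul_le_mul_of_nonneg_left (Real.exp_le_exp.2 (hS t ht δ hδ)) (Real.exp_nonneg _)
      _ = K := by
          simp only [hK]
          exact Finset.sum_congr rfl fun δ _ => by rw [Real.exp_add, mul_comm (Real.exp (a δ))]
  -- (k) integrate
  have hint : ∀ C ∈ L.powerset,
      IntervalIntegrable (fun t => ‖f C t‖ * Real.exp (∑ γ ∈ C, d γ)) MeasureTheory.volume 0 1 := by
    intro C hC
    have hCL : C ⊆ L := Finset.mem_powerset.1 hC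
    exact ((hfc C hCL).norm.mul continuousOn_const).intervalIntegrable
  calc ∑ C ∈ L.powerset, ‖truncatedWeight inc wA C - truncatedWeight inc wB C‖ *
        Real.exp (∑ γ ∈ C, d γ)
      = ∑ C ∈ L.powerset, ‖∫ t in (0 : ℝ)..1, f C t‖ * Real.exp (∑ γ ∈ C, d γ) := by
        refine Finset.sum_congr rfl fun C hC => ?_
        rw [hrep C (Finset.mem_powerset.1 hC)]
    _ ≤ ∑ C ∈ L.powerset, (∫ t in (0 : ℝ)..1, ‖f C t‖) * Real.exp (∑ γ ∈ C, d γ) :=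
        Finset.sum_le_sum fun C _ => mul_le_mul_of_nonneg_right
          (intervalIntegral.norm_integral_le_integral_norm zero_le_one) (Real.exp_nonneg _)
    _ = ∑ C ∈ L.powerset, ∫ t in (0 : ℝ)..1, ‖f C t‖ * Real.exp (∑ γ ∈ C, d γ) :=
        Finset.sum_congr rfl fun C _ => (intervalIntegral.integral_mul_const _ _).symm
    _ = ∫ t in (0 : ℝ)..1, ∑ C ∈ L.powerset, ‖f C t‖ * Real.exp (∑ γ ∈ C, d γ) :=
        (intervalIntegral.integral_finsetSum hint).symm
    _ ≤ ∫ _ in (0 : ℝ)..1, K := by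
        refine intervalIntegral.integral_mono_on zero_le_one ?_ ?_ fun t ht => hpt t ht
        · have h := IntervalIntegrable.sum L.powerset hint
          rwa [Finset.sum_fn] at h
        · exact intervalIntegrable_const
    _ = K := by simp

/-! ### Consequences in the shapes consumers use -/

/-- **One piece.** Under the hypotheses of `sum_norm_truncatedWeight_sub_mul_exp_le`, for every
`C ⊆ L`: `‖Φ^T(C; wA) - Φ^T(C; wB)‖ e^{d(C)} ≤ Σ_{δ ∈ L} ‖wA δ - wB δ‖ e^{a δ + d δ}`. [folklore] -/
theorem norm_truncatedWeight_sub_mul_exp_le [Std.Refl inc] [Std.Symm inc]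
    {wA wB : P → ℂ} {a d : P → ℝ} (ha : ∀ γ, 0 ≤ a γ) (hd : ∀ γ, 0 ≤ d γ) {L : Finset P}
    (h1A : ∀ γ ∈ L, ∑ γ' ∈ L with inc γ' γ, ‖wA γ'‖ * Real.exp (a γ' + d γ') ≤ a γ)
    (h1B : ∀ γ ∈ L, ∑ γ' ∈ L with inc γ' γ, ‖wB γ'‖ * Real.exp (a γ' + d γ') ≤ a γ)
    {C : Finset P} (hC : C ⊆ L) :
    ‖truncatedWeight inc wA C - truncatedWeight inc wB C‖ * Real.exp (∑ γ ∈ C, d γ) ≤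
      ∑ δ ∈ L, ‖wA δ - wB δ‖ * Real.exp (a δ + d δ) := by
  refine le_trans ?_ (sum_norm_truncatedWeight_sub_mul_exp_le ha hd h1A h1B)
  exact Finset.single_le_sum (f := fun C => ‖truncatedWeight inc wA C - truncatedWeight inc wB C‖ *
      Real.exp (∑ γ ∈ C, d γ)) (fun C _ => mul_nonneg (norm_nonneg _) (Real.exp_nonneg _))
    (Finset.mem_powerset.2 hC)

/-- **Any sub-family of pieces** (e.g. the pieces anchored at a polymer, `KPTouches inc C γ`, or
at a region): `Σ_{C ⊆ L, p C} ‖Φ^T(C; wA) - Φ^T(C; wB)‖ e^{d(C)} ≤ Σ_{δ ∈ L} ‖wA δ - wB δ‖ e^{a δ + d δ}`.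
[folklore] -/
theorem sum_filter_norm_truncatedWeight_sub_mul_exp_le [Std.Refl inc] [Std.Symm inc]
    {wA wB : P → ℂ} {a d : P → ℝ} (ha : ∀ γ, 0 ≤ a γ) (hd : ∀ γ, 0 ≤ d γ) {L : Finset P}
    (h1A : ∀ γ ∈ L, ∑ γ' ∈ L with inc γ' γ, ‖wA γ'‖ * Real.exp (a γ' + d γ') ≤ a γ)
    (h1B : ∀ γ ∈ L, ∑ γ' ∈ L with inc γ' γ, ‖wB γ'‖ * Real.exp (a γ' + d γ') ≤ a γ)
    (p : Finset P → Prop) [DecidablePred p] :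
    ∑ C ∈ L.powerset with p C, ‖truncatedWeight inc wA C - truncatedWeight inc wB C‖ *
        Real.exp (∑ γ ∈ C, d γ) ≤
      ∑ δ ∈ L, ‖wA δ - wB δ‖ * Real.exp (a δ + d δ) :=
  (Finset.sum_le_sum_of_subset_of_nonneg (Finset.filter_subset _ _)
    fun _ _ _ => mul_nonneg (norm_nonneg _) (Real.exp_nonneg _)).trans
    (sum_norm_truncatedWeight_sub_mul_exp_le ha hd h1A h1B)

/-- **Decay survives subtraction.** If every piece of the sub-family `p` has weight
`d(C) ≥ m`, then `Σ_{C ⊆ L, p C} ‖Φ^T(C; wA) - Φ^T(C; wB)‖ ≤ e^{-m} Σ_{δ ∈ L} ‖wA δ - wB δ‖ e^{a δ + d δ}`: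
the two families' pieces far from (or large around) an anchor differ by an exponentially small
total, with the activity discrepancy as the rate. [folklore] -/
theorem sum_filter_norm_truncatedWeight_sub_le_exp_neg_mul [Std.Refl inc] [Std.Symm inc]
    {wA wB : P → ℂ} {a d : P → ℝ} (ha : ∀ γ, 0 ≤ a γ) (hd : ∀ γ, 0 ≤ d γ) {L : Finset P}
    (h1A : ∀ γ ∈ L, ∑ γ' ∈ L with inc γ' γ, ‖wA γ'‖ * Real.exp (a γ' + d γ') ≤ a γ)
    (h1B : ∀ γ ∈ L, ∑ γ' ∈ L with inc γ' γ, ‖wB γ'‖ * Real.exp (a γ' + d γ') ≤ a γ)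
    (p : Finset P → Prop) [DecidablePred p] {m : ℝ}
    (hm : ∀ C ⊆ L, p C → m ≤ ∑ γ ∈ C, d γ) :
    ∑ C ∈ L.powerset with p C, ‖truncatedWeight inc wA C - truncatedWeight inc wB C‖ ≤
      Real.exp (-m) * ∑ δ ∈ L, ‖wA δ - wB δ‖ * Real.exp (a δ + d δ) := by
  have hpiece : ∀ C ∈ L.powerset.filter p,
      ‖truncatedWeight inc wA C - truncatedWeight inc wB C‖ ≤
        Real.exp (-m) * (‖truncatedWeight inc wA C - truncatedWeight inc wB C‖ *
          Real.exp (∑ γ ∈ C, d γ)) := by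
    intro C hC
    obtain ⟨hCL, hpC⟩ := Finset.mem_filter.1 hC
    have hmC := hm C (Finset.mem_powerset.1 hCL) hpC
    have hkey : (1 : ℝ) ≤ Real.exp (-m) * Real.exp (∑ γ ∈ C, d γ) := by
      rw [← Real.exp_add]
      exact Real.one_le_exp (by linarith)
    have hn := norm_nonneg (truncatedWeight inc wA C - truncatedWeight inc wB C)
    calc ‖truncatedWeight inc wA C - truncatedWeight inc wB C‖
        = ‖truncatedWeight inc wA C - truncatedWeight inc wB C‖ * 1 := (mul_one _).symm
      _ ≤ ‖truncatedWeight inc wA C - truncatedWeight inc wB C‖ *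
            (Real.exp (-m) * Real.exp (∑ γ ∈ C, d γ)) := mul_le_mul_of_nonneg_left hkey hn
      _ = Real.exp (-m) * (‖truncatedWeight inc wA C - truncatedWeight inc wB C‖ *
            Real.exp (∑ γ ∈ C, d γ)) := by ring
  calc ∑ C ∈ L.powerset with p C, ‖truncatedWeight inc wA C - truncatedWeight inc wB C‖
      ≤ ∑ C ∈ L.powerset with p C, Real.exp (-m) *
          (‖truncatedWeight inc wA C - truncatedWeight inc wB C‖ * Real.exp (∑ γ ∈ C, d γ)) :=
        Finset.sum_le_sum hpiece
    _ = Real.exp (-m) * ∑ C ∈ L.powerset with p C,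
          ‖truncatedWeight inc wA C - truncatedWeight inc wB C‖ * Real.exp (∑ γ ∈ C, d γ) := by
        rw [Finset.mul_sum]
    _ ≤ Real.exp (-m) * ∑ δ ∈ L, ‖wA δ - wB δ‖ * Real.exp (a δ + d δ) :=
        mul_le_mul_of_nonneg_left (sum_filter_norm_truncatedWeight_sub_mul_exp_le ha hd h1A h1B p)
          (Real.exp_nonneg _)

/-- **Rate form.** If the two families differ by a RATE, `‖wA δ - wB δ‖ ≤ ε u δ` on `L`, then
`Σ_{C ⊆ L} ‖Φ^T(C; wA) - Φ^T(C; wB)‖ e^{d(C)} ≤ ε Σ_{δ ∈ L} u δ e^{a δ + d δ}`. [folklore] -/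
theorem sum_norm_truncatedWeight_sub_mul_exp_le_of_rate [Std.Refl inc] [Std.Symm inc]
    {wA wB : P → ℂ} {a d : P → ℝ} (ha : ∀ γ, 0 ≤ a γ) (hd : ∀ γ, 0 ≤ d γ) {L : Finset P}
    (h1A : ∀ γ ∈ L, ∑ γ' ∈ L with inc γ' γ, ‖wA γ'‖ * Real.exp (a γ' + d γ') ≤ a γ)
    (h1B : ∀ γ ∈ L, ∑ γ' ∈ L with inc γ' γ, ‖wB γ'‖ * Real.exp (a γ' + d γ') ≤ a γ)
    {ε : ℝ} {u : P → ℝ} (hrate : ∀ δ ∈ L, ‖wA δ - wB δ‖ ≤ ε * u δ) :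
    ∑ C ∈ L.powerset, ‖truncatedWeight inc wA C - truncatedWeight inc wB C‖ *
        Real.exp (∑ γ ∈ C, d γ) ≤
      ε * ∑ δ ∈ L, u δ * Real.exp (a δ + d δ) := by
  refine (sum_norm_truncatedWeight_sub_mul_exp_le ha hd h1A h1B).trans ?_
  rw [Finset.mul_sum]
  refine Finset.sum_le_sum fun δ hδ => ?_
  have h := mul_le_mul_of_nonneg_right (hrate δ hδ) (Real.exp_nonneg (a δ + d δ))
  linarith [h, mul_assoc ε (u δ) (Real.exp (a δ + d δ))]

/-! ### The anchored form with a local right-hand side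

A second weight `e ≥ 0` enters hypothesis (1) together with `d` (as `d + e`) and is kept as a
surplus: on a sub-family of pieces whose surplus is `≥ m` the `e^{d(C)}`-weighted two-family
bound gains the factor `e^{-m}`; for two families agreeing off a set `T` only the clusters
meeting `T` matter; switching the activities one polymer at a time then discounts the
discrepancy at each polymer `δ` by the surplus cost `m(δ)` of the clusters of the sub-family
through `δ`. -/

omit [DecidableEq P] in
/-- Hypothesis (1) passes from a dominating profile `ω ≥ ‖w‖` (on `L`) to the activities `w`.
[folklore] -/
theorem kpd_of_norm_le {w : P → ℂ} {ω a d : P → ℝ} {L : Finset P}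
    (hω : ∀ δ ∈ L, ‖w δ‖ ≤ ω δ)
    (hdom : ∀ γ ∈ L, ∑ γ' ∈ L with inc γ' γ, ω γ' * Real.exp (a γ' + d γ') ≤ a γ) :
    ∀ γ ∈ L, ∑ γ' ∈ L with inc γ' γ, ‖w γ'‖ * Real.exp (a γ' + d γ') ≤ a γ := fun γ hγ =>
  (Finset.sum_le_sum fun γ' hγ' => mul_le_mul_of_nonneg_right
    (hω γ' (Finset.mem_filter.1 hγ').1) (Real.exp_nonneg _)).trans (hdom γ hγ)

/-- **Surplus weight gives a small factor.** If `a, d, e ≥ 0`, both families satisfy (1) with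
the weight `d + e`, and every piece of the sub-family `p` with a NON-ZERO difference has surplus
`e(C) = Σ_{γ ∈ C} e γ ≥ m`, then
`Σ_{C ⊆ L, p C} ‖Φ^T(C; wA) - Φ^T(C; wB)‖ e^{d(C)} ≤ e^{-m} Σ_{δ ∈ L} ‖wA δ - wB δ‖ e^{a δ + d δ + e δ}`.
[folklore] -/
theorem sum_filter_norm_truncatedWeight_sub_mul_exp_le_exp_neg_mul [Std.Refl inc] [Std.Symm inc]
    {wA wB : P → ℂ} {a d e : P → ℝ} (ha : ∀ γ, 0 ≤ a γ) (hd : ∀ γ, 0 ≤ d γ) (he : ∀ γ, 0 ≤ e γ)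
    {L : Finset P}
    (h1A : ∀ γ ∈ L, ∑ γ' ∈ L with inc γ' γ, ‖wA γ'‖ * Real.exp (a γ' + (d γ' + e γ')) ≤ a γ)
    (h1B : ∀ γ ∈ L, ∑ γ' ∈ L with inc γ' γ, ‖wB γ'‖ * Real.exp (a γ' + (d γ' + e γ')) ≤ a γ)
    (p : Finset P → Prop) [DecidablePred p] {m : ℝ}
    (hm : ∀ C ⊆ L, p C → truncatedWeight inc wA C ≠ truncatedWeight inc wB C → m ≤ ∑ γ ∈ C, e γ) :
    ∑ C ∈ L.powerset with p C, ‖truncatedWeight inc wA C - truncatedWeight inc wB C‖ *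
        Real.exp (∑ γ ∈ C, d γ) ≤
      Real.exp (-m) * ∑ δ ∈ L, ‖wA δ - wB δ‖ * Real.exp (a δ + (d δ + e δ)) := by
  have hde : ∀ γ, 0 ≤ d γ + e γ := fun γ => add_nonneg (hd γ) (he γ)
  have hmain := sum_filter_norm_truncatedWeight_sub_mul_exp_le (d := fun γ => d γ + e γ)
    ha hde h1A h1B p
  have hpiece : ∀ C ∈ L.powerset.filter p,
      ‖truncatedWeight inc wA C - truncatedWeight inc wB C‖ * Real.exp (∑ γ ∈ C, d γ) ≤
        Real.exp (-m) * (‖truncatedWeight inc wA C - truncatedWeight inc wB C‖ *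
          Real.exp (∑ γ ∈ C, (d γ + e γ))) := by
    intro C hC
    obtain ⟨hCL, hpC⟩ := Finset.mem_filter.1 hC
    by_cases hne : truncatedWeight inc wA C = truncatedWeight inc wB C
    · rw [hne, sub_self, norm_zero, zero_mul, zero_mul, mul_zero]
    have hmC := hm C (Finset.mem_powerset.1 hCL) hpC hne
    have hsplit : ∑ γ ∈ C, (d γ + e γ) = ∑ γ ∈ C, d γ + ∑ γ ∈ C, e γ := Finset.sum_add_distrib
    have hkey : Real.exp (∑ γ ∈ C, d γ) ≤ Real.exp (-m) * Real.exp (∑ γ ∈ C, (d γ + e γ)) := by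
      rw [← Real.exp_add, hsplit]
      exact Real.exp_le_exp.2 (by linarith)
    have hn := norm_nonneg (truncatedWeight inc wA C - truncatedWeight inc wB C)
    calc ‖truncatedWeight inc wA C - truncatedWeight inc wB C‖ * Real.exp (∑ γ ∈ C, d γ)
        ≤ ‖truncatedWeight inc wA C - truncatedWeight inc wB C‖ *
            (Real.exp (-m) * Real.exp (∑ γ ∈ C, (d γ + e γ))) := mul_le_mul_of_nonneg_left hkey hn
      _ = Real.exp (-m) * (‖truncatedWeight inc wA C - truncatedWeight inc wB C‖ *
            Real.exp (∑ γ ∈ C, (d γ + e γ))) := by ring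
  calc ∑ C ∈ L.powerset with p C, ‖truncatedWeight inc wA C - truncatedWeight inc wB C‖ *
        Real.exp (∑ γ ∈ C, d γ)
      ≤ ∑ C ∈ L.powerset with p C, Real.exp (-m) *
          (‖truncatedWeight inc wA C - truncatedWeight inc wB C‖ *
            Real.exp (∑ γ ∈ C, (d γ + e γ))) := Finset.sum_le_sum hpiece
    _ = Real.exp (-m) * ∑ C ∈ L.powerset with p C,
          ‖truncatedWeight inc wA C - truncatedWeight inc wB C‖ *
            Real.exp (∑ γ ∈ C, (d γ + e γ)) := by rw [Finset.mul_sum]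
    _ ≤ Real.exp (-m) * ∑ δ ∈ L, ‖wA δ - wB δ‖ * Real.exp (a δ + (d δ + e δ)) :=
        mul_le_mul_of_nonneg_left hmain (Real.exp_nonneg _)

/-- **Two families agreeing off a set `T`.** If `wA = wB` on `L ∖ T`, a piece `C ⊆ L` with
`Φ^T(C; wA) ≠ Φ^T(C; wB)` is a CLUSTER (`truncatedWeight_eq_zero_of_kp`) MEETING `T`
(`truncatedWeight_congr`); so the surplus hypothesis of
`sum_filter_norm_truncatedWeight_sub_mul_exp_le_exp_neg_mul` is only needed on those, and the
right-hand side only sees `T`: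
`Σ_{C ⊆ L, p C} ‖Φ^T(C; wA) - Φ^T(C; wB)‖ e^{d(C)} ≤ e^{-m} Σ_{δ ∈ L ∩ T} ‖wA δ - wB δ‖ e^{a δ + d δ + e δ}`.
[cite: KoteckyPreiss1986, Theorem p. 492 (last assertion) and (2)] -/
theorem sum_filter_norm_truncatedWeight_sub_mul_exp_le_of_eqOn_compl [Std.Refl inc] [Std.Symm inc]
    {wA wB : P → ℂ} {a d e : P → ℝ} (ha : ∀ γ, 0 ≤ a γ) (hd : ∀ γ, 0 ≤ d γ) (he : ∀ γ, 0 ≤ e γ)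
    {L T : Finset P}
    (h1A : ∀ γ ∈ L, ∑ γ' ∈ L with inc γ' γ, ‖wA γ'‖ * Real.exp (a γ' + (d γ' + e γ')) ≤ a γ)
    (h1B : ∀ γ ∈ L, ∑ γ' ∈ L with inc γ' γ, ‖wB γ'‖ * Real.exp (a γ' + (d γ' + e γ')) ≤ a γ)
    (hagree : ∀ δ ∈ L, δ ∉ T → wA δ = wB δ)
    (p : Finset P → Prop) [DecidablePred p] {m : ℝ}
    (hm : ∀ C ⊆ L, p C → IsPolymerCluster inc C → (C ∩ T).Nonempty → m ≤ ∑ γ ∈ C, e γ) :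
    ∑ C ∈ L.powerset with p C, ‖truncatedWeight inc wA C - truncatedWeight inc wB C‖ *
        Real.exp (∑ γ ∈ C, d γ) ≤
      Real.exp (-m) * ∑ δ ∈ L with δ ∈ T, ‖wA δ - wB δ‖ * Real.exp (a δ + (d δ + e δ)) := by
  have hde : ∀ γ, 0 ≤ d γ + e γ := fun γ => add_nonneg (hd γ) (he γ)
  have hKPA : IsKPVolume inc wA a L := isKPVolume_of_kpd (d := fun γ => d γ + e γ) hde h1A
  have hKPB : IsKPVolume inc wB a L := isKPVolume_of_kpd (d := fun γ => d γ + e γ) hde h1B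
  -- the surplus hypothesis in the form of the previous theorem
  have hm' : ∀ C ⊆ L, p C → truncatedWeight inc wA C ≠ truncatedWeight inc wB C →
      m ≤ ∑ γ ∈ C, e γ := by
    intro C hCL hpC hne
    have hCl : IsPolymerCluster inc C := by
      by_contra hCl
      exact hne (by rw [truncatedWeight_eq_zero_of_kp hKPA hCL hCl,
        truncatedWeight_eq_zero_of_kp hKPB hCL hCl])
    have hT : (C ∩ T).Nonempty := by
      by_contra hT
      rw [Finset.not_nonempty_iff_eq_empty] at hT
      refine hne (truncatedWeight_congr fun γ hγ => hagree γ (hCL hγ) fun hγT => ?_)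
      have : γ ∈ C ∩ T := Finset.mem_inter.2 ⟨hγ, hγT⟩
      rw [hT] at this
      exact Finset.notMem_empty γ this
    exact hm C hCL hpC hCl hT
  refine (sum_filter_norm_truncatedWeight_sub_mul_exp_le_exp_neg_mul ha hd he h1A h1B p hm').trans
    (le_of_eq ?_)
  congr 1
  rw [Finset.sum_filter]
  refine Finset.sum_congr rfl fun δ hδ => ?_
  split_ifs with hδT
  · rfl
  · rw [hagree δ hδ hδT, sub_self, norm_zero, zero_mul]

/-- **The anchored form with a local right-hand side.** Let `a, d, e ≥ 0`, let `ω` be a common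
dominating profile of the two families on `L` (`‖wA δ‖, ‖wB δ‖ ≤ ω δ`) satisfying hypothesis
(1) with the weight `d + e`, and let `m : P → ℝ` be such that every CLUSTER `C ⊆ L` of the
sub-family `p` through `δ` has surplus `Σ_{γ ∈ C} e γ ≥ m δ`. Then
`Σ_{C ⊆ L, p C} ‖Φ^T(C; wA) - Φ^T(C; wB)‖ e^{d(C)} ≤ Σ_{δ ∈ L} e^{-m δ} ‖wA δ - wB δ‖ e^{a δ + d δ + e δ}`:
the discrepancy at `δ` is discounted by the surplus cost of the `p`-clusters through `δ`
(for `p C = C ι γ`: of joining `δ` to the anchor `γ`). Proof: switch the activities from `wB`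
to `wA` one polymer of `L` at a time (`Finset.piecewise`; every hybrid family is dominated by
`ω`, hence satisfies (1)), and apply `sum_filter_norm_truncatedWeight_sub_mul_exp_le_of_eqOn_compl`
with `T = {δ}` at each step. [folklore] -/
theorem sum_filter_norm_truncatedWeight_sub_mul_exp_le_local [Std.Refl inc] [Std.Symm inc]
    {wA wB : P → ℂ} {ω a d e : P → ℝ} (ha : ∀ γ, 0 ≤ a γ) (hd : ∀ γ, 0 ≤ d γ) (he : ∀ γ, 0 ≤ e γ)
    {L : Finset P} (hωA : ∀ δ ∈ L, ‖wA δ‖ ≤ ω δ) (hωB : ∀ δ ∈ L, ‖wB δ‖ ≤ ω δ)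
    (hdom : ∀ γ ∈ L, ∑ γ' ∈ L with inc γ' γ, ω γ' * Real.exp (a γ' + (d γ' + e γ')) ≤ a γ)
    (p : Finset P → Prop) [DecidablePred p] {m : P → ℝ}
    (hm : ∀ C ⊆ L, p C → IsPolymerCluster inc C → ∀ δ ∈ C, m δ ≤ ∑ γ ∈ C, e γ) :
    ∑ C ∈ L.powerset with p C, ‖truncatedWeight inc wA C - truncatedWeight inc wB C‖ *
        Real.exp (∑ γ ∈ C, d γ) ≤
      ∑ δ ∈ L, Real.exp (-m δ) * (‖wA δ - wB δ‖ * Real.exp (a δ + (d δ + e δ))) := by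
  -- hybrid families: `wA` on `S`, `wB` elsewhere; all dominated by `ω` on `L`
  have hhyb : ∀ S : Finset P, ∀ δ ∈ L, ‖S.piecewise wA wB δ‖ ≤ ω δ := by
    intro S δ hδ
    by_cases hS : δ ∈ S
    · rw [Finset.piecewise_eq_of_mem _ _ _ hS]; exact hωA δ hδ
    · rw [Finset.piecewise_eq_of_notMem _ _ _ hS]; exact hωB δ hδ
  have h1S : ∀ S : Finset P, ∀ γ ∈ L, ∑ γ' ∈ L with inc γ' γ,
      ‖S.piecewise wA wB γ'‖ * Real.exp (a γ' + (d γ' + e γ')) ≤ a γ := fun S =>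
    kpd_of_norm_le (hhyb S) hdom
  -- the weighted difference functional
  set Φd : (P → ℂ) → (P → ℂ) → ℝ := fun u u' => ∑ C ∈ L.powerset with p C,
    ‖truncatedWeight inc u C - truncatedWeight inc u' C‖ * Real.exp (∑ γ ∈ C, d γ) with hΦd
  have htri : ∀ u u' u'' : P → ℂ, Φd u u'' ≤ Φd u u' + Φd u' u'' := by
    intro u u' u''
    simp only [hΦd, ← Finset.sum_add_distrib, ← add_mul]
    refine Finset.sum_le_sum fun C _ => mul_le_mul_of_nonneg_right ?_ (Real.exp_nonneg _)
    have h : truncatedWeight inc u C - truncatedWeight inc u'' C =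
        (truncatedWeight inc u C - truncatedWeight inc u' C) +
          (truncatedWeight inc u' C - truncatedWeight inc u'' C) := by ring
    rw [h]
    exact norm_add_le _ _
  -- one step: switching the polymer `δ₀ ∈ L ∖ S`
  have hstep : ∀ S : Finset P, ∀ δ₀ ∈ L, δ₀ ∉ S →
      Φd ((insert δ₀ S).piecewise wA wB) (S.piecewise wA wB) ≤
        Real.exp (-m δ₀) * (‖wA δ₀ - wB δ₀‖ * Real.exp (a δ₀ + (d δ₀ + e δ₀))) := by
    intro S δ₀ hδ₀L hδ₀S
    have hagree : ∀ δ ∈ L, δ ∉ ({δ₀} : Finset P) →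
        (insert δ₀ S).piecewise wA wB δ = S.piecewise wA wB δ := by
      intro δ _ hδ
      rw [Finset.mem_singleton] at hδ
      rw [Finset.piecewise_insert_of_ne S wA wB hδ]
    have hm' : ∀ C ⊆ L, p C → IsPolymerCluster inc C → (C ∩ {δ₀}).Nonempty →
        m δ₀ ≤ ∑ γ ∈ C, e γ := by
      intro C hCL hpC hCl hCT
      obtain ⟨x, hx⟩ := hCT
      rw [Finset.mem_inter, Finset.mem_singleton] at hx
      obtain ⟨hxC, rfl⟩ := hx
      exact hm C hCL hpC hCl _ hxC
    have h := sum_filter_norm_truncatedWeight_sub_mul_exp_le_of_eqOn_compl ha hd he (T := {δ₀})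
      (h1S (insert δ₀ S)) (h1S S) hagree p hm'
    refine h.trans (le_of_eq ?_)
    congr 1
    have hfilter : (L.filter fun δ => δ ∈ ({δ₀} : Finset P)) = {δ₀} := by
      ext δ
      simp only [Finset.mem_filter, Finset.mem_singleton]
      constructor
      · rintro ⟨-, rfl⟩; rfl
      · rintro rfl; exact ⟨hδ₀L, rfl⟩
    rw [hfilter, Finset.sum_singleton, Finset.piecewise_eq_of_mem _ _ _ (Finset.mem_insert_self δ₀ S),
      Finset.piecewise_eq_of_notMem _ _ _ hδ₀S]
  -- induction on the set of switched polymers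
  have hind : ∀ S : Finset P, S ⊆ L →
      Φd (S.piecewise wA wB) wB ≤
        ∑ δ ∈ S, Real.exp (-m δ) * (‖wA δ - wB δ‖ * Real.exp (a δ + (d δ + e δ))) := by
    intro S
    induction S using Finset.induction_on with
    | empty =>
        intro _
        simp only [hΦd, Finset.piecewise_empty, sub_self, norm_zero, zero_mul,
          Finset.sum_const_zero, Finset.sum_empty, le_refl]
    | insert δ₀ S hδ₀S ih =>
        intro hSL
        have hδ₀L : δ₀ ∈ L := hSL (Finset.mem_insert_self δ₀ S)
        have hSL' : S ⊆ L := fun δ hδ => hSL (Finset.mem_insert_of_mem hδ)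
        rw [Finset.sum_insert hδ₀S]
        exact (htri _ (S.piecewise wA wB) _).trans (add_le_add (hstep S δ₀ hδ₀L hδ₀S) (ih hSL'))
  -- at `S = L` the hybrid family is `wA` on `L`
  have hL := hind L le_rfl
  have hΦA : Φd (L.piecewise wA wB) wB = Φd wA wB := by
    simp only [hΦd]
    refine Finset.sum_congr rfl fun C hC => ?_
    have hCL : C ⊆ L := Finset.mem_powerset.1 (Finset.mem_filter.1 hC).1
    rw [truncatedWeight_congr (inc := inc) (w := L.piecewise wA wB) (w' := wA)
      fun γ hγ => Finset.piecewise_eq_of_mem _ _ _ (hCL hγ)]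
  rw [hΦA] at hL
  exact hL

/-! ### Localized pieces

A localization map `loc : Finset P → ι` assigns a domain to every finite family of polymers;
the pieces `R_w(i) = Σ_{C ⊆ L, loc C = i} Φ^T(C; w)` of `log Z(L; w) = Σ_{C ⊆ L} Φ^T(C; w)`
collect disjoint families of clusters, so a decay profile `κ` of the domains dominated by the
weight, `κ (loc C) ≤ d(C)`, survives the two-family subtraction piece by piece. -/

/-- **Decay of localized pieces survives subtraction.** Under the hypotheses of
`sum_norm_truncatedWeight_sub_mul_exp_le`, for a localization map `loc`, a finite set of
domains `I` and a profile `κ` with `κ (loc C) ≤ Σ_{γ ∈ C} d γ` for the families `C ⊆ L`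
localized in `I`:
`Σ_{i ∈ I} e^{κ i} ‖Σ_{C ⊆ L, loc C = i} (Φ^T(C; wA) - Φ^T(C; wB))‖ ≤ Σ_{δ ∈ L} ‖wA δ - wB δ‖ e^{a δ + d δ}`.
[folklore] -/
theorem sum_exp_mul_norm_sum_truncatedWeight_sub_le_of_loc [Std.Refl inc] [Std.Symm inc]
    {wA wB : P → ℂ} {a d : P → ℝ} (ha : ∀ γ, 0 ≤ a γ) (hd : ∀ γ, 0 ≤ d γ) {L : Finset P}
    (h1A : ∀ γ ∈ L, ∑ γ' ∈ L with inc γ' γ, ‖wA γ'‖ * Real.exp (a γ' + d γ') ≤ a γ)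
    (h1B : ∀ γ ∈ L, ∑ γ' ∈ L with inc γ' γ, ‖wB γ'‖ * Real.exp (a γ' + d γ') ≤ a γ)
    {ι : Type*} [DecidableEq ι] (loc : Finset P → ι) (I : Finset ι) {κ : ι → ℝ}
    (hκ : ∀ C ⊆ L, loc C ∈ I → κ (loc C) ≤ ∑ γ ∈ C, d γ) :
    ∑ i ∈ I, Real.exp (κ i) *
        ‖∑ C ∈ L.powerset with loc C = i, (truncatedWeight inc wA C - truncatedWeight inc wB C)‖ ≤
      ∑ δ ∈ L, ‖wA δ - wB δ‖ * Real.exp (a δ + d δ) := by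
  -- each piece against the weighted norms of its clusters
  have hpiece : ∀ i ∈ I, Real.exp (κ i) *
      ‖∑ C ∈ L.powerset with loc C = i, (truncatedWeight inc wA C - truncatedWeight inc wB C)‖ ≤
        ∑ C ∈ L.powerset with loc C = i,
          ‖truncatedWeight inc wA C - truncatedWeight inc wB C‖ * Real.exp (∑ γ ∈ C, d γ) := by
    intro i hi
    calc Real.exp (κ i) *
          ‖∑ C ∈ L.powerset with loc C = i, (truncatedWeight inc wA C - truncatedWeight inc wB C)‖
        ≤ Real.exp (κ i) * ∑ C ∈ L.powerset with loc C = i,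
            ‖truncatedWeight inc wA C - truncatedWeight inc wB C‖ :=
          mul_le_mul_of_nonneg_left (norm_sum_le _ _) (Real.exp_nonneg _)
      _ = ∑ C ∈ L.powerset with loc C = i,
            Real.exp (κ i) * ‖truncatedWeight inc wA C - truncatedWeight inc wB C‖ :=
          Finset.mul_sum _ _ _
      _ ≤ ∑ C ∈ L.powerset with loc C = i,
            ‖truncatedWeight inc wA C - truncatedWeight inc wB C‖ * Real.exp (∑ γ ∈ C, d γ) := by
          refine Finset.sum_le_sum fun C hC => ?_
          obtain ⟨hCL, hCi⟩ := Finset.mem_filter.1 hC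
          have hκC : κ i ≤ ∑ γ ∈ C, d γ := by
            have h := hκ C (Finset.mem_powerset.1 hCL) (by rw [hCi]; exact hi)
            rwa [hCi] at h
          rw [mul_comm]
          exact mul_le_mul_of_nonneg_left (Real.exp_le_exp.2 hκC) (norm_nonneg _)
  -- distinct pieces collect disjoint families
  have hfib : ∑ i ∈ I, ∑ C ∈ L.powerset with loc C = i,
      ‖truncatedWeight inc wA C - truncatedWeight inc wB C‖ * Real.exp (∑ γ ∈ C, d γ) ≤
        ∑ C ∈ L.powerset,
          ‖truncatedWeight inc wA C - truncatedWeight inc wB C‖ * Real.exp (∑ γ ∈ C, d γ) := by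
    calc ∑ i ∈ I, ∑ C ∈ L.powerset with loc C = i,
          ‖truncatedWeight inc wA C - truncatedWeight inc wB C‖ * Real.exp (∑ γ ∈ C, d γ)
        = ∑ i ∈ I, ∑ C ∈ L.powerset, (if loc C = i then
            ‖truncatedWeight inc wA C - truncatedWeight inc wB C‖ * Real.exp (∑ γ ∈ C, d γ)
            else 0) := Finset.sum_congr rfl fun i _ => by rw [Finset.sum_filter]
      _ = ∑ C ∈ L.powerset, ∑ i ∈ I, (if loc C = i then
            ‖truncatedWeight inc wA C - truncatedWeight inc wB C‖ * Real.exp (∑ γ ∈ C, d γ)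
            else 0) := Finset.sum_comm
      _ = ∑ C ∈ L.powerset, (if loc C ∈ I then
            ‖truncatedWeight inc wA C - truncatedWeight inc wB C‖ * Real.exp (∑ γ ∈ C, d γ)
            else 0) := Finset.sum_congr rfl fun C _ => by rw [Finset.sum_ite_eq]
      _ ≤ ∑ C ∈ L.powerset,
            ‖truncatedWeight inc wA C - truncatedWeight inc wB C‖ * Real.exp (∑ γ ∈ C, d γ) := by
          refine Finset.sum_le_sum fun C _ => ?_
          split_ifs
          · exact le_rfl
          · exact mul_nonneg (norm_nonneg _) (Real.exp_nonneg _)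
  exact (Finset.sum_le_sum hpiece).trans (hfib.trans
    (sum_norm_truncatedWeight_sub_mul_exp_le ha hd h1A h1B))

/-- **Decay of localized pieces survives subtraction — profile on nonempty clusters only.**
Under the hypotheses of `sum_norm_truncatedWeight_sub_mul_exp_le`, for a localization map `loc`,
a finite set of domains `I` and a profile `κ` with `κ (loc C) ≤ Σ_{γ ∈ C} d γ` for the NONEMPTY
`inc`-CLUSTERS `C ⊆ L` localized in `I`:
`Σ_{i ∈ I} e^{κ i} ‖Σ_{C ⊆ L, loc C = i} (Φ^T(C; wA) - Φ^T(C; wB))‖ ≤ Σ_{δ ∈ L} ‖wA δ - wB δ‖ e^{a δ + d δ}`.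
The families that are not clusters have `Φ^T = 0` for both activity families ([KP86] Theorem,
last assertion: `truncatedWeight_eq_zero_of_kp` with `isKPVolume_of_kpd`), and the empty family
has the same truncated functional for both (`truncatedWeight_congr`), so neither constrains `κ`.
(v1.3) [folklore] -/
theorem sum_exp_mul_norm_sum_truncatedWeight_sub_le_of_loc_cluster [Std.Refl inc] [Std.Symm inc]
    {wA wB : P → ℂ} {a d : P → ℝ} (ha : ∀ γ, 0 ≤ a γ) (hd : ∀ γ, 0 ≤ d γ) {L : Finset P}
    (h1A : ∀ γ ∈ L, ∑ γ' ∈ L with inc γ' γ, ‖wA γ'‖ * Real.exp (a γ' + d γ') ≤ a γ)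
    (h1B : ∀ γ ∈ L, ∑ γ' ∈ L with inc γ' γ, ‖wB γ'‖ * Real.exp (a γ' + d γ') ≤ a γ)
    {ι : Type*} [DecidableEq ι] (loc : Finset P → ι) (I : Finset ι) {κ : ι → ℝ}
    (hκ : ∀ C ⊆ L, C.Nonempty → IsPolymerCluster inc C → loc C ∈ I → κ (loc C) ≤ ∑ γ ∈ C, d γ) :
    ∑ i ∈ I, Real.exp (κ i) *
        ‖∑ C ∈ L.powerset with loc C = i, (truncatedWeight inc wA C - truncatedWeight inc wB C)‖ ≤
      ∑ δ ∈ L, ‖wA δ - wB δ‖ * Real.exp (a δ + d δ) := by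
  have hKPA : IsKPVolume inc wA a L := isKPVolume_of_kpd hd h1A
  have hKPB : IsKPVolume inc wB a L := isKPVolume_of_kpd hd h1B
  -- each piece against the weighted norms of its nonempty clusters
  have hpiece : ∀ i ∈ I, Real.exp (κ i) *
      ‖∑ C ∈ L.powerset with loc C = i, (truncatedWeight inc wA C - truncatedWeight inc wB C)‖ ≤
        ∑ C ∈ L.powerset with loc C = i,
          ‖truncatedWeight inc wA C - truncatedWeight inc wB C‖ * Real.exp (∑ γ ∈ C, d γ) := by
    intro i hi
    calc Real.exp (κ i) *
          ‖∑ C ∈ L.powerset with loc C = i, (truncatedWeight inc wA C - truncatedWeight inc wB C)‖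
        ≤ Real.exp (κ i) * ∑ C ∈ L.powerset with loc C = i,
            ‖truncatedWeight inc wA C - truncatedWeight inc wB C‖ :=
          mul_le_mul_of_nonneg_left (norm_sum_le _ _) (Real.exp_nonneg _)
      _ = ∑ C ∈ L.powerset with loc C = i,
            Real.exp (κ i) * ‖truncatedWeight inc wA C - truncatedWeight inc wB C‖ :=
          Finset.mul_sum _ _ _
      _ ≤ ∑ C ∈ L.powerset with loc C = i,
            ‖truncatedWeight inc wA C - truncatedWeight inc wB C‖ * Real.exp (∑ γ ∈ C, d γ) := by
          refine Finset.sum_le_sum fun C hC => ?_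
          obtain ⟨hCL, hCi⟩ := Finset.mem_filter.1 hC
          have hCL' : C ⊆ L := Finset.mem_powerset.1 hCL
          by_cases hΔ : truncatedWeight inc wA C - truncatedWeight inc wB C = 0
          · rw [hΔ, norm_zero, mul_zero, zero_mul]
          · -- a nonzero difference only occurs on a nonempty cluster
            have hne : C.Nonempty := by
              rw [Finset.nonempty_iff_ne_empty]
              rintro rfl
              exact hΔ (sub_eq_zero.2
                (truncatedWeight_congr fun γ hγ => absurd hγ (Finset.notMem_empty γ)))
            have hcl : IsPolymerCluster inc C := by
              by_contra hncl
              exact hΔ (by rw [truncatedWeight_eq_zero_of_kp hKPA hCL' hncl,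
                truncatedWeight_eq_zero_of_kp hKPB hCL' hncl, sub_zero])
            have hκC : κ i ≤ ∑ γ ∈ C, d γ := by
              have h := hκ C hCL' hne hcl (by rw [hCi]; exact hi)
              rwa [hCi] at h
            rw [mul_comm]
            exact mul_le_mul_of_nonneg_left (Real.exp_le_exp.2 hκC) (norm_nonneg _)
  -- distinct pieces collect disjoint families
  have hfib : ∑ i ∈ I, ∑ C ∈ L.powerset with loc C = i,
      ‖truncatedWeight inc wA C - truncatedWeight inc wB C‖ * Real.exp (∑ γ ∈ C, d γ) ≤
        ∑ C ∈ L.powerset,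
          ‖truncatedWeight inc wA C - truncatedWeight inc wB C‖ * Real.exp (∑ γ ∈ C, d γ) := by
    calc ∑ i ∈ I, ∑ C ∈ L.powerset with loc C = i,
          ‖truncatedWeight inc wA C - truncatedWeight inc wB C‖ * Real.exp (∑ γ ∈ C, d γ)
        = ∑ i ∈ I, ∑ C ∈ L.powerset, (if loc C = i then
            ‖truncatedWeight inc wA C - truncatedWeight inc wB C‖ * Real.exp (∑ γ ∈ C, d γ)
            else 0) := Finset.sum_congr rfl fun i _ => by rw [Finset.sum_filter]
      _ = ∑ C ∈ L.powerset, ∑ i ∈ I, (if loc C = i then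
            ‖truncatedWeight inc wA C - truncatedWeight inc wB C‖ * Real.exp (∑ γ ∈ C, d γ)
            else 0) := Finset.sum_comm
      _ = ∑ C ∈ L.powerset, (if loc C ∈ I then
            ‖truncatedWeight inc wA C - truncatedWeight inc wB C‖ * Real.exp (∑ γ ∈ C, d γ)
            else 0) := Finset.sum_congr rfl fun C _ => by rw [Finset.sum_ite_eq]
      _ ≤ ∑ C ∈ L.powerset,
            ‖truncatedWeight inc wA C - truncatedWeight inc wB C‖ * Real.exp (∑ γ ∈ C, d γ) := by
          refine Finset.sum_le_sum fun C _ => ?_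
          split_ifs
          · exact le_rfl
          · exact mul_nonneg (norm_nonneg _) (Real.exp_nonneg _)
  exact (Finset.sum_le_sum hpiece).trans (hfib.trans
    (sum_norm_truncatedWeight_sub_mul_exp_le ha hd h1A h1B))

end Literature.Probability.LatticeModels
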